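import Literature.RingTheory.CohomologyAnnihilator.StrongGenerator
import Literature.RingTheory.KrullDimension.AffineDimension
import Mathlib.FieldTheory.IsAlgClosed.AlgebraicClosure
import Mathlib.RingTheory.Flat.Basic
import Mathlib.RingTheory.IntegralClosure.Algebra.Basic
import Mathlib.RingTheory.FiniteStability
import HarnessLib

/-!
# Theorem 5.4 of Iyengar–Takahashi reduced to its three printed inputs

Topic: `Literature/RingTheory/CohomologyAnnihilator`. The proof of
[IyengarTakahashi2014, Theorem 5.4] ("`V(ca R) = V(ca^{2d+1} R) = Sing R` and `mod R` has a strong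
generator, for `R` a localisation of a finitely generated algebra of Krull dimension `d` over a
field `k`") runs: reduce to `A` finitely generated (done in `AnnihilationOfCohomologyProofs.lean`,
`StrongGenerator.lean`: `singEqVCa_essFiniteType_of_strongGenerator`); then

1. (perfect ground field) for every prime `𝔭` of `A`, `A/𝔭` has a separable noether
   normalisation (Nagata, Thm. 39.11), so Theorem 3.6 gives `ca^{dim A/𝔭 + 1}(A/𝔭) ≠ 0`;
2. Theorem 5.2 (the Dao–Takahashi induction) turns this into a strong generator
   `Ω^d(mod A) ⊆ |G|ₙ`;
3. (arbitrary ground field) apply 1–2 to `A ⊗_k K`, `K` an algebraic closure of `k` (perfect),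
   and descend the generator to `A` through a finite subextension (adapting
   Keller–Van den Bergh, Prop. 5.1.2, with the compactness Lemma 4.8).

This file PROVES the assembly of these three steps into the named fact
`singEqVCa_essFiniteType` (`AnnihilationOfCohomology.lean`), taking the three printed results as
explicit hypotheses stated in the tree's vocabulary (`cohomologyAnnihilatorOfDegree`, `IsSyzygy`,
`InTower`):

* `singEqVCa_essFiniteType_of_inputs (h₃₆ h₅₂ h_desc) : singEqVCa_essFiniteType`, where
  `h₃₆` = "an affine domain `B` over a PERFECT field with `dim B = e` has `ca^{e+1}(B) ≠ 0`"
  (Thm. 3.6 + Nagata 39.11 + Lemma 3.5), `h₅₂` = Theorem 5.2, `h_desc` = the descent step 3.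
  The glue proved here: `A ⊗_k K` is of finite type over `K`, noetherian, of Krull dimension
  `d` (`ringKrullDim_tensorProduct_of_isAlgebraic`: `A → A ⊗_k K` is injective and integral), and
  its quotients by primes are affine domains of finite dimension over the perfect field `K`.

What remains UNPROVED in the tree towards `singEqVCa_essFiniteType_holds` is exactly
`h₃₆`, `h₅₂`, `h_desc` (the bodies are spelled out in the statement below).

## References

* S. B. Iyengar, R. Takahashi, *Annihilation of cohomology and strong generation of module
  categories*, IMRN 2016; arXiv:1404.1476 — Theorems 3.6, 5.2, 5.4, Lemma 4.8.
  [`IyengarTakahashi2014`]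
-/

noncomputable section

open CategoryTheory CategoryTheory.Abelian
open scoped TensorProduct

universe u

namespace Literature.RingTheory.CohomologyAnnihilator

/-- For an algebraic field extension `K/k` and a `k`-algebra `A`, `dim (K ⊗_k A) = dim A`:
`A → A ⊗_k K` is injective (`A` is flat over the field `k`) and integral (`K` is integral over
`k`), and `K ⊗_k A ≅ A ⊗_k K`. [folklore] -/
theorem ringKrullDim_tensorProduct_of_isAlgebraic (k : Type u) [Field k] (K : Type u) [Field K]
    [Algebra k K] [Algebra.IsAlgebraic k K] (A : Type u) [CommRing A] [Algebra k A] :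
    ringKrullDim (K ⊗[k] A) = ringKrullDim A := by
  rw [ringKrullDim_eq_of_ringEquiv (Algebra.TensorProduct.comm k K A).toRingEquiv]
  have hinj : Function.Injective (algebraMap A (A ⊗[k] K)) :=
    Algebra.TensorProduct.includeLeft_injective (S := A) (algebraMap k K).injective
  exact (Literature.RingTheory.KrullDimension.ringKrullDim_eq_of_isIntegral hinj).symm

/-- A `WithBot ℕ∞` squeezed between `0` and a natural number is a natural number. [folklore] -/
theorem exists_nat_cast_eq_of_le {x : WithBot ℕ∞} {d : ℕ} (h0 : 0 ≤ x) (hd : x ≤ d) :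
    ∃ e : ℕ, x = e := by
  induction x using WithBot.recBotCoe with
  | bot => exact absurd h0 (by simp)
  | coe y =>
    induction y using ENat.recTopCoe with
    | top =>
      exfalso
      rw [← WithBot.coe_natCast, WithBot.coe_le_coe, top_le_iff] at hd
      exact ENat.coe_ne_top d hd
    | coe e => exact ⟨e, rfl⟩

/-- **Theorem 5.4 of [IyengarTakahashi2014] from its three printed inputs.** The named fact
`singEqVCa_essFiniteType` (`V(ca R) = V(ca^{2d+1} R) = Sing R` for localisations `R` of finitely
generated algebras of Krull dimension `d` over a field) follows from:
`h₃₆` — for a perfect field `K` and an affine DOMAIN `B` over `K` with `dim B = e`,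
`ca^{e+1}(B) ≠ 0` (Theorem 3.6 via a separable noether normalisation, Nagata 39.11, and
Lemma 3.5); `h₅₂` — Theorem 5.2: a commutative noetherian ring `R` of Krull dimension `d` such
that every `R/𝔭` has `caˢ(R/𝔭) ≠ 0` for some `s ≤ dim R/𝔭 + 1` admits `G ∈ mod R` and `n` with
`Ω^d(mod R) ⊆ |G|ₙ`; `h_desc` — the descent step of the proof of Theorem 5.4: a strong generator
of `mod (K ⊗_k A)` with parameter `d`, `K` an algebraically closed algebraic extension of `k`,
yields one of `mod A` with parameter `d`. Given these, for `A` of finite type over `k` with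
`dim A = d`: `K ⊗_k A` (`K = k̄`) is of finite type over the perfect field `K`, noetherian, of
dimension `d`, its prime quotients are affine domains of dimension `≤ d`, so `h₃₆` feeds `h₅₂`,
`h_desc` descends, and `singEqVCa_essFiniteType_of_strongGenerator` concludes.
[cite: IyengarTakahashi2014, Thm. 5.4 (proof)] -/
theorem singEqVCa_essFiniteType_of_inputs
    (h₃₆ : ∀ (K : Type u) [Field K] [PerfectField K] (B : Type u) [CommRing B] [IsDomain B]
      [Algebra K B], Algebra.FiniteType K B → ∀ e : ℕ, ringKrullDim B = e →
        cohomologyAnnihilatorOfDegree B (e + 1) ≠ ⊥)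
    (h₅₂ : ∀ (R : Type u) [CommRing R] [IsNoetherianRing R] (d : ℕ), ringKrullDim R = d →
      (∀ (𝔭 : Ideal R) [𝔭.IsPrime], ∃ s : ℕ, (s : WithBot ℕ∞) ≤ ringKrullDim (R ⧸ 𝔭) + 1 ∧
        cohomologyAnnihilatorOfDegree (R ⧸ 𝔭) s ≠ ⊥) →
      ∃ G : ModuleCat.{u} R, Module.Finite R G ∧ ∃ n : ℕ, ∀ M : ModuleCat.{u} R,
        Module.Finite R M → ∃ K : ModuleCat.{u} R, IsSyzygy d M K ∧ InTower G n K)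
    (h_desc : ∀ (k : Type u) [Field k] (K : Type u) [Field K] [Algebra k K] [IsAlgClosed K]
      [Algebra.IsAlgebraic k K] (A : Type u) [CommRing A] [Algebra k A], Algebra.FiniteType k A →
      ∀ d : ℕ, (∃ G : ModuleCat.{u} (K ⊗[k] A), Module.Finite (K ⊗[k] A) G ∧ ∃ n : ℕ,
          ∀ M : ModuleCat.{u} (K ⊗[k] A), Module.Finite (K ⊗[k] A) M →
            ∃ K' : ModuleCat.{u} (K ⊗[k] A), IsSyzygy d M K' ∧ InTower G n K') →
        ∃ G : ModuleCat.{u} A, Module.Finite A G ∧ ∃ n : ℕ, ∀ M : ModuleCat.{u} A,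
          Module.Finite A M → ∃ K' : ModuleCat.{u} A, IsSyzygy d M K' ∧ InTower G n K') :
    singEqVCa_essFiniteType.{u} := by
  refine singEqVCa_essFiniteType_of_strongGenerator fun k _ A _ _ hA d hd => ?_
  let K : Type u := AlgebraicClosure k
  haveI : Algebra.FiniteType k A := hA
  haveI : IsNoetherianRing (K ⊗[k] A) := Algebra.FiniteType.isNoetherianRing K _
  have hdim : ringKrullDim (K ⊗[k] A) = d := by
    rw [ringKrullDim_tensorProduct_of_isAlgebraic]; exact hd
  refine h_desc k K A hA d (h₅₂ (K ⊗[k] A) d hdim fun 𝔓 _ => ?_)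
  -- `B = (K ⊗ A)/𝔓` is an affine domain over the perfect field `K`, of dimension `e ≤ d`
  haveI : Nontrivial ((K ⊗[k] A) ⧸ 𝔓) := Ideal.Quotient.nontrivial_iff.mpr (Ideal.IsPrime.ne_top ‹_›)
  obtain ⟨e, he⟩ : ∃ e : ℕ, ringKrullDim ((K ⊗[k] A) ⧸ 𝔓) = e :=
    exists_nat_cast_eq_of_le ringKrullDim_nonneg_of_nontrivial
      (hdim ▸ ringKrullDim_quotient_le 𝔓)
  refine ⟨e + 1, by rw [he]; exact le_rfl, h₃₆ K _ inferInstance e he⟩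

end Literature.RingTheory.CohomologyAnnihilator

end
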